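import Literature.LinearAlgebra.Matrix.PrincipalMinorMap

/-!
# Principal minors and cycle monomials: the null cone (towards Lin–Sturmfels 2009, Thm. 1)

Source: Shaowei Lin, Bernd Sturmfels, *Polynomial relations among principal minors of a
`4 × 4`-matrix*, J. Algebra **322** (2009) 4121–4131, arXiv:0812.0601 [LinSturmfels2009], §2.

For a permutation `π` the *cycle monomial* is `c_π = ∏_{i ≠ π i} x_{i π(i)}` (ibid., §2); for a
square matrix `B` and a cyclic permutation `σ` we write it as the Lean term
`∏ x ∈ σ.support, B x (σ x)` (no new definition is introduced).  This file proves the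
**null-cone statement** behind Theorem 1 of [LinSturmfels2009]:

* `LinSturmfels.nullCone` — if every principal minor `B_I`, `I ≠ ∅`, of a square matrix `B` over a
  domain vanishes, then every diagonal entry and every cycle monomial of `B` vanishes.

The proof is a strong induction on the length of the cycle: by the Leibniz expansion of `B_I` as a
signed sum over permutations of `I` ([LinSturmfels2009], Prop. 4, eq. (1);
`LinSturmfels.principalMinorMap_eq_sum`), every term that is not a full cycle on `I` contains a
shorter cycle (or a diagonal entry) and vanishes by induction, so the cycle monomials of the full
cycles on `I` sum to zero; and the product of the cycle monomials of two *distinct* full cycles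
`f ≠ g` on `I` is divisible by the cycle monomial of the strictly shorter cycle
`x → g x = f^j x → f^{j+1} x → ⋯ → f^{k-1} x → x` (this is the cycle `C₁` of the key claim in
the proof of [LinSturmfels2009], Lemma 6), hence vanishes
(`LinSturmfels.prod_mul_prod_eq_zero_of_isCycle`).  A finite family with zero sum and zero
pairwise products is zero.

This replaces, for the purpose of the closedness theorem (`PrincipalMinorMapProofs.lean`), the
integrality statement [LinSturmfels2009], Prop. 7 (whose set-theoretic shadow it is, by Hilbert's
criterion); only the elementary statement above is needed there.
-/

noncomputable section

open Matrix Equiv Finset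

namespace Literature.LinearAlgebra.Matrix

namespace LinSturmfels

section CommRing

variable {m : Type*} [Fintype m] [DecidableEq m] {K : Type*} [CommRing K]

/-- The `1 × 1` principal minor `B_{{i}}` is the diagonal entry `B i i`.
[cite: LinSturmfels2009, §2] -/
theorem principalMinorMap_singleton (B : Matrix m m K) (i : m) :
    principalMinorMap B {i} = B i i := by
  unfold principalMinorMap
  rw [Matrix.det_eq_elem_of_card_eq_one (by simp) ⟨i, Finset.mem_singleton_self i⟩]
  simp

/-- Leibniz expansion of the principal minor `B_I` as a signed sum over the permutations `τ` of
`I` of the monomials `∏_{x ∈ I} B x (τ x)` (row convention; `τ` is extended by the identity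
outside `I`).  [cite: LinSturmfels2009, Proposition 4] -/
theorem principalMinorMap_eq_sum (B : Matrix m m K) (I : Finset m) :
    principalMinorMap B I =
      ∑ τ : Perm ↥I, Equiv.Perm.sign τ • ∏ x ∈ I, B x (Equiv.Perm.ofSubtype τ x) := by
  unfold principalMinorMap
  rw [← Matrix.det_transpose, Matrix.det_apply]
  refine Finset.sum_congr rfl (fun τ _ => ?_)
  congr 1
  rw [← Finset.prod_coe_sort I (fun x => B x (Equiv.Perm.ofSubtype τ x))]
  refine Fintype.prod_congr _ _ (fun x => ?_)
  simp [Matrix.transpose_apply, Matrix.submatrix_apply, Equiv.Perm.ofSubtype_apply_coe]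

/-- A permutation of `↥I`, extended by the identity, moves only points of `I`. [folklore] -/
theorem support_ofSubtype_subset {I : Finset m} (τ : Perm ↥I) :
    (Equiv.Perm.ofSubtype τ).support ⊆ I := by
  intro x hx
  by_contra hxI
  exact (Equiv.Perm.mem_support.mp hx) (Equiv.Perm.ofSubtype_apply_of_not_mem τ hxI)

/-- If the cycle of `g` through `x₀` already moves every point moved by `g`, then `g` is that
cycle. [folklore] -/
theorem eq_cycleOf_of_support_eq (g : Perm m) (x₀ : m)
    (h : (g.cycleOf x₀).support = g.support) : g.cycleOf x₀ = g := by
  ext y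
  by_cases hy : g.SameCycle x₀ y
  · rw [hy.cycleOf_apply]
  · have hy' : y ∉ (g.cycleOf x₀).support := fun hmem =>
      hy (Equiv.Perm.mem_support_cycleOf_iff.mp hmem).1
    have h1 : g.cycleOf x₀ y = y := Equiv.Perm.notMem_support.mp hy'
    have h2 : g y = y := Equiv.Perm.notMem_support.mp (h ▸ hy')
    rw [h1, h2]

/-- Induction step, non-cyclic terms: if the diagonal of `B` vanishes and all cycle monomials of
cycles shorter than `|I|` vanish, then the Leibniz term `∏_{x ∈ I} B x (g x)` of every permutation
`g` supported in `I` which is NOT a full cycle on `I` vanishes (it contains a fixed point, i.e. a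
diagonal entry, or a proper sub-cycle `g.cycleOf x₀`). [cite: LinSturmfels2009, Proposition 4] -/
theorem term_eq_zero_of_not_isCycle (B : Matrix m m K) (hdiag : ∀ i, B i i = 0) {I : Finset m}
    (hI : I.Nonempty)
    (ih : ∀ ρ : Perm m, ρ.IsCycle → ρ.support.card < I.card → ∏ x ∈ ρ.support, B x (ρ x) = 0)
    (g : Perm m) (hgI : g.support ⊆ I) (hng : ¬ (g.IsCycle ∧ g.support = I)) :
    ∏ x ∈ I, B x (g x) = 0 := by
  classical
  by_cases hfix : ∃ x ∈ I, g x = x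
  · obtain ⟨x, hxI, hx⟩ := hfix
    exact Finset.prod_eq_zero hxI (by rw [hx]; exact hdiag x)
  · push Not at hfix
    have hsupp : g.support = I :=
      Finset.Subset.antisymm hgI (fun x hx => Equiv.Perm.mem_support.mpr (hfix x hx))
    have hnc : ¬ g.IsCycle := fun hc => hng ⟨hc, hsupp⟩
    obtain ⟨x₀, hx₀⟩ := hI
    have hgx₀ : g x₀ ≠ x₀ := hfix x₀ hx₀
    have hγc : (g.cycleOf x₀).IsCycle := Equiv.Perm.isCycle_cycleOf g hgx₀
    have hγsub : (g.cycleOf x₀).support ⊆ I := hsupp ▸ Equiv.Perm.support_cycleOf_le g x₀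
    have hγne : (g.cycleOf x₀).support ≠ I := fun h =>
      hnc (eq_cycleOf_of_support_eq g x₀ (h.trans hsupp.symm) ▸ hγc)
    have hγcard : (g.cycleOf x₀).support.card < I.card :=
      Finset.card_lt_card (Finset.ssubset_iff_subset_ne.mpr ⟨hγsub, hγne⟩)
    have h0 := ih _ hγc hγcard
    rw [← Finset.prod_sdiff hγsub]
    refine mul_eq_zero_of_right _ ?_
    rw [← h0]
    refine Finset.prod_congr rfl (fun y hy => ?_)
    rw [(Equiv.Perm.mem_support_cycleOf_iff.mp hy).1.cycleOf_apply]

end CommRing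

section IsDomain

variable {m : Type*} [Fintype m] [DecidableEq m] {K : Type*} [CommRing K] [IsDomain K]

/-- In a domain, a finite family with zero sum and zero pairwise products is identically zero.
[folklore] -/
theorem eq_zero_of_sum_eq_zero_of_pairwise_mul_eq_zero {ι : Type*} (s : Finset ι) (f : ι → K)
    (hsum : ∑ i ∈ s, f i = 0) (hmul : ∀ i ∈ s, ∀ j ∈ s, i ≠ j → f i * f j = 0) :
    ∀ i ∈ s, f i = 0 := by
  intro i hi
  have h1 : f i * ∑ j ∈ s, f j = f i * f i := by
    rw [Finset.mul_sum]
    exact Finset.sum_eq_single_of_mem i hi (fun j hj hji => hmul i hi j hj (Ne.symm hji))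
  rw [hsum, mul_zero] at h1
  exact mul_self_eq_zero.mp h1.symm

/-- **Two distinct full cycles.** Let `f ≠ g` be permutations moving exactly the points of `I`,
`f` cyclic, and suppose all cycle monomials of cycles shorter than `|I|` vanish on `B`.  Then the
product of the Leibniz terms `(∏_{x∈I} B x (f x)) · (∏_{x∈I} B x (g x))` vanishes: choosing `x`
with `g x ≠ f x` and writing `g x = f^j x` (`2 ≤ j < |I|`), the product is divisible by the cycle
monomial of the strictly shorter cycle `x → f^j x → f^{j+1} x → ⋯ → f^{|I|-1} x → x` (one edge
of `g`, the others of `f`; the cycle `C₁` of the key claim in the proof of Lemma 6 of the source).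
[cite: LinSturmfels2009, Lemma 6] -/
theorem prod_mul_prod_eq_zero_of_isCycle (B : Matrix m m K) {f g : Perm m} {I : Finset m}
    (hf : f.IsCycle) (hfs : f.support = I) (hgs : g.support = I) (hne : f ≠ g)
    (ih : ∀ ρ : Perm m, ρ.IsCycle → ρ.support.card < I.card →
      ∏ x ∈ ρ.support, B x (ρ x) = 0) :
    (∏ x ∈ I, B x (f x)) * ∏ x ∈ I, B x (g x) = 0 := by
  classical
  -- a point where `f` and `g` differ
  obtain ⟨x, hx⟩ : ∃ x, f x ≠ g x := by
    by_contra h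
    push Not at h
    exact hne (Equiv.ext h)
  have hxI : x ∈ I := by
    by_contra hxI
    have h1 : f x = x := Equiv.Perm.notMem_support.mp (hfs ▸ hxI)
    have h2 : g x = x := Equiv.Perm.notMem_support.mp (hgs ▸ hxI)
    exact hx (h1.trans h2.symm)
  have hfx : f x ≠ x := Equiv.Perm.mem_support.mp (hfs ▸ hxI)
  have hgx : g x ≠ x := Equiv.Perm.mem_support.mp (hgs ▸ hxI)
  have hyI : g x ∈ I := by
    have : g x ∈ g.support := Equiv.Perm.apply_mem_support.mpr (hgs ▸ hxI)
    rwa [hgs] at this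
  have hfy : f (g x) ≠ g x := Equiv.Perm.mem_support.mp (hfs ▸ hyI)
  -- the order of `f`
  have hord : orderOf f = I.card := by rw [hf.orderOf, hfs]
  have hk2 : 2 ≤ I.card := by rw [← hfs]; exact hf.two_le_card_support
  -- `g x = f^j x` with `2 ≤ j < |I|`
  obtain ⟨i, hi⟩ := hf.exists_pow_eq hfx hfy
  obtain ⟨j, hjk, hjy⟩ : ∃ j, j < I.card ∧ (f ^ j) x = g x :=
    ⟨i % I.card, Nat.mod_lt _ (by omega), by rw [← hord, pow_mod_orderOf, hi]⟩
  have hj0 : j ≠ 0 := by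
    rintro rfl
    rw [pow_zero, Equiv.Perm.one_apply] at hjy
    exact hgx hjy.symm
  have hj1 : j ≠ 1 := by
    rintro rfl
    rw [pow_one] at hjy
    exact hx hjy
  have hfk : ∀ t, (f ^ (I.card + t)) x = (f ^ t) x := fun t => by
    rw [pow_add, ← hord, pow_orderOf_eq_one, one_mul]
  -- the list `[x, f x, …, f^{k-1} x]`
  set l := f.toList x with hl
  have hlen : l.length = I.card := by
    rw [hl, Equiv.Perm.length_toList, hf.cycleOf_eq hfx, hfs]
  have hlget : ∀ (t : ℕ) (ht : t < l.length), l[t] = (f ^ t) x := fun t ht =>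
    Equiv.Perm.getElem_toList f x t ht
  -- the short cycle `x → f^j x → f^{j+1} x → ⋯ → f^{k-1} x → x`, as a list
  set L : List m := x :: l.drop j with hL
  have hLlen : L.length = I.card - j + 1 := by
    simp [hL, List.length_drop, hlen]
  -- its vertices as `f`-iterates of `x`
  let e : ℕ → ℕ := fun t => if t = 0 then 0 else j + t - 1
  have hLget : ∀ (t : ℕ) (ht : t < L.length), L[t] = (f ^ (e t)) x := by
    intro t ht
    rcases t with _ | t
    · simp [hL, e]
    · simp [hL, e, List.getElem_drop, hlget]
  have hLnodup : L.Nodup := by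
    rw [hL, List.nodup_cons]
    refine ⟨fun hmem => ?_,
      List.Nodup.sublist (List.drop_sublist j l) (Equiv.Perm.nodup_toList f x)⟩
    obtain ⟨t, ht, htx⟩ := List.getElem_of_mem hmem
    rw [List.getElem_drop] at htx
    have ht' : j + t < l.length := by
      simp [List.length_drop] at ht; omega
    have h0 : l[0]'(by omega) = x := by rw [hlget]; simp
    have := (Equiv.Perm.nodup_toList f x).getElem_inj_iff.mp (htx.trans h0.symm)
    omega
  have hL2 : 2 ≤ L.length := by omega
  have hLk : L.length < I.card := by omega
  -- the corresponding cyclic permutation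
  set ρ := L.formPerm with hρ
  have hρc : ρ.IsCycle := List.isCycle_formPerm hLnodup hL2
  have hρs : ρ.support = L.toFinset :=
    List.support_formPerm_of_nodup L hLnodup (fun z h => by
      have := congrArg List.length h
      simp at this; omega)
  have hρcard : ρ.support.card < I.card := by
    rw [hρs, List.toFinset_card_of_nodup hLnodup]; exact hLk
  have hρ0 := ih ρ hρc hρcard
  rw [hρs, List.prod_toFinset _ hLnodup, List.prod_eq_zero_iff, List.mem_map] at hρ0
  obtain ⟨z, hzL, hz0⟩ := hρ0
  obtain ⟨t, ht, rfl⟩ := List.getElem_of_mem hzL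
  rw [hρ, List.formPerm_apply_getElem _ hLnodup] at hz0
  simp only [hLget] at hz0
  rcases Nat.eq_zero_or_pos t with rfl | htpos
  · -- the edge `x → g x` of `g`
    have h1 : (0 + 1) % L.length = 1 := Nat.mod_eq_of_lt (by omega)
    rw [h1] at hz0
    simp only [e, if_true, if_false, one_ne_zero, pow_zero, Equiv.Perm.one_apply] at hz0
    have : j + 1 - 1 = j := by omega
    rw [this, hjy] at hz0
    exact mul_eq_zero_of_right _ (Finset.prod_eq_zero hxI hz0)
  · -- an edge `z → f z` of `f`
    have hz : (f ^ e ((t + 1) % L.length)) x = f ((f ^ (e t)) x) := by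
      have het : e t = j + t - 1 := by simp [e, Nat.pos_iff_ne_zero.mp htpos]
      rw [het, ← Equiv.Perm.mul_apply, ← pow_succ']
      by_cases hlt : t + 1 < L.length
      · rw [Nat.mod_eq_of_lt hlt]
        simp only [e, Nat.add_eq_zero_iff, one_ne_zero, and_false, if_false]
        congr 2; omega
      · have heq : t + 1 = L.length := by omega
        rw [heq, Nat.mod_self]
        simp only [e, if_true, pow_zero, Equiv.Perm.one_apply]
        have : j + t - 1 + 1 = I.card + 0 := by omega
        rw [this, hfk, pow_zero, Equiv.Perm.one_apply]
    rw [hz] at hz0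
    have hzI : (f ^ (e t)) x ∈ I := by
      rw [← hfs]; exact Equiv.Perm.pow_apply_mem_support.mpr (hfs ▸ hxI)
    exact mul_eq_zero_of_left (Finset.prod_eq_zero hzI hz0) _

/-- Induction step of the null-cone lemma: if the diagonal of `B` vanishes, all cycle monomials of
cycles shorter than the cyclic permutation `σ` vanish, and the principal minor `B_I`,
`I = supp σ`, vanishes, then the cycle monomial of `σ` vanishes.  (Leibniz expansion; the
non-cyclic terms vanish; the full cycles on `I` have constant sign, zero sum and zero pairwise
products.) [cite: LinSturmfels2009, Proposition 4 & Lemma 6] -/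
theorem nullCone_step (B : Matrix m m K) (hdiag : ∀ i, B i i = 0) (σ : Perm m)
    (hσ : σ.IsCycle)
    (ih : ∀ ρ : Perm m, ρ.IsCycle → ρ.support.card < σ.support.card →
      ∏ x ∈ ρ.support, B x (ρ x) = 0)
    (hdet : principalMinorMap B σ.support = 0) :
    ∏ x ∈ σ.support, B x (σ x) = 0 := by
  classical
  have hIne : σ.support.Nonempty :=
    Finset.card_pos.mp (lt_of_lt_of_le Nat.zero_lt_two hσ.two_le_card_support)
  set I := σ.support with hI
  set G : Finset (Perm ↥I) := Finset.univ.filter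
    (fun τ => (Equiv.Perm.ofSubtype τ).IsCycle ∧ (Equiv.Perm.ofSubtype τ).support = I) with hG
  have hsum := principalMinorMap_eq_sum B I
  rw [hdet] at hsum
  have hsumG : ∑ τ ∈ G, Equiv.Perm.sign τ • ∏ x ∈ I, B x (Equiv.Perm.ofSubtype τ x) = 0 := by
    rw [hsum]
    refine Finset.sum_subset (Finset.filter_subset _ _) (fun τ _ hτ => ?_)
    have hng : ¬ ((Equiv.Perm.ofSubtype τ).IsCycle ∧ (Equiv.Perm.ofSubtype τ).support = I) :=
      fun h => hτ (Finset.mem_filter.mpr ⟨Finset.mem_univ _, h⟩)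
    rw [term_eq_zero_of_not_isCycle B hdiag hIne ih _ (support_ofSubtype_subset τ) hng,
      smul_zero]
  have hsumG' : ∑ τ ∈ G, ∏ x ∈ I, B x (Equiv.Perm.ofSubtype τ x) = 0 := by
    have : ∑ τ ∈ G, Equiv.Perm.sign τ • ∏ x ∈ I, B x (Equiv.Perm.ofSubtype τ x) =
        (-(-1) ^ I.card : ℤˣ) • ∑ τ ∈ G, ∏ x ∈ I, B x (Equiv.Perm.ofSubtype τ x) := by
      rw [Finset.smul_sum]
      refine Finset.sum_congr rfl (fun τ hτ => ?_)
      obtain ⟨hc, hs'⟩ := (Finset.mem_filter.mp hτ).2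
      rw [← Equiv.Perm.sign_ofSubtype, hc.sign, hs']
      rfl
    rw [this] at hsumG
    exact (smul_eq_zero_iff_eq _).mp hsumG
  have hpair : ∀ τ₁ ∈ G, ∀ τ₂ ∈ G, τ₁ ≠ τ₂ →
      (∏ x ∈ I, B x (Equiv.Perm.ofSubtype τ₁ x)) *
        ∏ x ∈ I, B x (Equiv.Perm.ofSubtype τ₂ x) = 0 := by
    intro τ₁ h₁ τ₂ h₂ hne
    obtain ⟨hc₁, hs₁⟩ := (Finset.mem_filter.mp h₁).2
    obtain ⟨_, hs₂⟩ := (Finset.mem_filter.mp h₂).2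
    exact prod_mul_prod_eq_zero_of_isCycle B hc₁ hs₁ hs₂
      (fun h => hne (Equiv.Perm.ofSubtype_injective h)) ih
  have hall := eq_zero_of_sum_eq_zero_of_pairwise_mul_eq_zero G _ hsumG' hpair
  set τ₀ : Perm ↥I := σ.subtypePerm (fun x => Equiv.Perm.apply_mem_support) with hτ₀
  have hτ₀σ : Equiv.Perm.ofSubtype τ₀ = σ :=
    Equiv.Perm.ofSubtype_subtypePerm _ (fun x hx => Equiv.Perm.mem_support.mpr hx)
  have hτ₀G : τ₀ ∈ G :=
    Finset.mem_filter.mpr ⟨Finset.mem_univ _, by rw [hτ₀σ]; exact ⟨hσ, rfl⟩⟩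
  have := hall τ₀ hτ₀G
  rwa [hτ₀σ] at this

/-- **Null cone of the principal minor map** (set-theoretic form of [LinSturmfels2009], Prop. 7,
used for Theorem 1): if all principal minors `B_I`, `I ≠ ∅`, of a square matrix `B` over a domain
vanish, then all diagonal entries `B i i` and all cycle monomials `∏_{x ∈ supp σ} B x (σ x)`
(`σ` a cyclic permutation) vanish.  Strong induction on `|supp σ|` via `nullCone_step`.
[cite: LinSturmfels2009, Proposition 7] -/
theorem nullCone (B : Matrix m m K)
    (h0 : ∀ I : Finset m, I.Nonempty → principalMinorMap B I = 0) :
    (∀ i, B i i = 0) ∧ ∀ σ : Perm m, σ.IsCycle → ∏ x ∈ σ.support, B x (σ x) = 0 := by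
  have hdiag : ∀ i, B i i = 0 := fun i => by
    rw [← principalMinorMap_singleton B i]; exact h0 {i} (Finset.singleton_nonempty i)
  refine ⟨hdiag, ?_⟩
  suffices h : ∀ k, ∀ σ : Perm m, σ.IsCycle → σ.support.card = k →
      ∏ x ∈ σ.support, B x (σ x) = 0 from fun σ hσ => h _ σ hσ rfl
  intro k
  induction k using Nat.strong_induction_on with
  | _ k ih =>
    intro σ hσ hk
    exact nullCone_step B hdiag σ hσ (fun ρ hρ hlt => ih _ (hk ▸ hlt) ρ hρ rfl)
      (h0 _ (Finset.card_pos.mp (lt_of_lt_of_le Nat.zero_lt_two hσ.two_le_card_support)))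

end IsDomain

end LinSturmfels

end Literature.LinearAlgebra.Matrix
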